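import Literature.IUT.HodgeArakelov.ThetaKummerAutMap
import Literature.AnabelianGeometry.EtaleTheta.Discharge.Sec2Prop214iiiAutInduces
import HarnessLib

/-!
# [EtTh] Prop 1.4 (ii) for the INVERSION at the level of the étale theta class: the binder `hιη` of
# GAP-LEDGER row G-L2t2-1 DERIVED from the FUNCTION-level Prop 1.4 package on `Θ̈` (proof-only)

S. Mochizuki, *The étale theta function and its Frobenioid-theoretic manifestations*, Publ. RIMS **45**
(2009): Prop 1.4 (ii) p. 22 (PDF; printed p. 248) «`Θ̈(Ü) = −Θ̈(Ü⁻¹)`; `Θ̈(−Ü) = −Θ̈(Ü)`», Prop 1.3 / 1.4 (iii)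
p. 22 (the class `η̈^Θ` is the Kummer class of `Θ̈`), Thm 1.6 (i)–(iii) p. 24 (an isomorphism `γ` with its theta
companion transports `H¹(Π^tp_Ÿ, Δ_Θ)`), Def 2.1 p. 36 / Prop 2.2 (i) p. 37 (the inversion `ι`), Def 2.7 p. 41
(`[Π^tp_Y̲̲ : Π^tp_Ÿ̲̲] = 2`), Prop 2.14 (iii) pp. 49–50. [EtTh] is refereed and classical here.

abc-iut cell, layer L2, seat abc-iut-w5-d125 (gen 7); PROOF-ONLY companion (NO definition, NO `Prop` fact, NO
instance; D-0067). DISPOSITION of GAP-LEDGER row **G-L2t2-1** (abc-iut-L2-t2, 2026-08-26T10:31:51Z): the binder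
`hιη : ∃ τ ∈ Π^tp_X̲̲, transport c h η̈^Θ = conj τ η̈^Θ` («the inversion carries the étale theta class to a
`Π^tp_X̲̲`-conjugate of itself») of abc-iut-L2-t2's `rigidData_exists_monoIso_over_inversion(_tower)`
(`Discharge/Sec2Prop214iiiInversionOfModel.lean`, [EtTh] Prop 2.14 (iii) `{±1}`-part at the §1 model) is
DERIVED — at ANY `ThetaSetting`, not at a model — from the FUNCTION-level [EtTh] Prop 1.4 package on
abc-iut-L2-t12's `ThetaKummerInput T` along the route `η̈^Θ := κ(Θ̈)` (`E.etaDd = T.kummerTheta`, the R-8/R-9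
reading of `ThetaKummerClass.lean`), exactly as the gap row asks («prove in-cone … at `etaDd := kummerTheta`
once `Fn` carries the action»: the action of `ι` on functions IS the binder `ιFn` with its twisted
equivariance `hιFn`). The L6 twin of this reduction for the binders `horb`/`hroots` is abc-iut-w4-d004's
`BadPrimeGaussianMonoidsGenuineRecordOrbitOfThetaKummer.lean`.

* `ContH1Aut.autMap_kummerContClass` — GENERIC transport of structure for continuous Kummer classes along an
  automorphism pair `(α, β)` of `(G, G')` (abc-iut-L6-t1's `ContH1Aut.autMap`, the `Π`-level twin WITHOUT
  pull-back of this seat's `ContH1Aut.autMap_comap_kummerContClass`, `ThetaKummerAutMap.lean`): for a pull-back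
  of functions `ιFn : A →* A` that is `α`-twisted equivariant (`ιFn (g • f) = α g • ιFn f`) and compatible with
  the coefficients (`β ∘ c = c ∘ Λ(ιFn)`), `autMap (κ(x)) = κ(x.map ιFn)` — a cocycle-level identity.
* `ThetaKummerInput.autMap_kummerTheta` / `…_eq_conj` — with the first equation of Prop 1.4 (ii) at the function
  level, `hιθ : ιFn Θ̈ = const(−1) · Θ̈`: `(ι, β)·κ(Θ̈) = κ(−1)·κ(Θ̈)`; adding the deck form `hdeck` of the second
  equation (this seat's `ThetaKummerDeck.lean`) and a deck element `ε₀ ∈ Π^tp_Y ∖ Π^tp_Ÿ`: `= conj ε₀ κ(Θ̈)`.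
* `EtaleThetaData.transport_etaDd_eq_conj_of_thetaKummer` — for an INVERSION DATUM of §1 (`ι` with theta
  companion `c`, `Thm16i ι`): `transport c h η̈^Θ = conj ε₀ η̈^Θ` (abc-iut-L2-t2's `transport_eq_autMap`).
* `EtaleThetaData.DoubleUnderline.exists_mem_Huu_mem_GtpY_not_mem_GtpYdd` — a deck element INSIDE `Π^tp_X̲̲`
  (from abc-iut-L2-t8's `relIndex_GtpYdd_inf`, `[Π^tp_Y̲̲ : Π^tp_Ÿ̲̲] = 2`, under `Sec2Hyps`).
* **`EtaleThetaData.DoubleUnderline.exists_mem_Huu_transport_etaDd_eq_conj_of_thetaKummer`** — LITERALLY the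
  binder `hιη` of G-L2t2-1.
* `…coeffMap_hom_eq_of_acts_trivially` — under Prop 2.2 (i) («`ι` acts on `Δ_Θ` by `+1`», the consumer's `hβ`)
  the coefficient compatibility collapses to «`Λ(ιFn)` is the identity on the image in `Δ_Θ`», i.e.
  `c(Λ(ιFn) ζ) = c(ζ)` (pull-back by an automorphism of the curve fixes the roots of unity).
* **`rigidData_exists_monoIso_over_inversion_of_thetaKummer`** / **`…_tower_of_thetaKummer`** — END-TO-END:
  abc-iut-L2-t2's Prop 2.14 (iii) `{±1}`-part at the §1 model with `hιη` DISCHARGED; residual = the inversion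
  datum, the FUNCTION-level package (`T`, `hη`, `ιFn`, `hιFn`, `hΛ`, `hιθ`, `hdeck`), Prop 1.5 (iii) (+ (ii) for
  the tower) and Cor 2.18 (ii) / the cyclotome tower — NO class-level hypothesis;
  `rigidData_exists_monoIso_induces_over_inversion(_tower)_of_thetaKummer` — the same in the `RigidData.Induces`
  currency of the typed `Prop214_iii_mono` (abc-iut-L2-t2's `Discharge/Sec2Prop214iiiAutInduces.lean`).

HONEST FRAMING: [EtTh] Prop 1.4 is classical and undisputed; composition of landed theorems; nothing here
asserts anything disputed, and nothing bears on or takes a side on [IUTchIII] Cor 3.12; typed ≠ proved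
elsewhere. Universe `Type` as in `Setting.lean`.
-/

noncomputable section

/-! ### §1. Transport of continuous Kummer classes along automorphism pairs (generic, `Π`-level) -/

namespace Literature.IUT.HodgeArakelov

open Literature.AnabelianGeometry.EtaleTheta

namespace ContH1Aut

variable {G G' : Type} [Group G] [TopologicalSpace G] [SeparatelyContinuousMul G]
  [Group G'] [TopologicalSpace G'] [IsTopologicalGroup G']
  {φ : G →* G'} {A' : Subgroup G'} [A'.Normal] [IsMulCommutative A']
  {A : Type} [CommGroup A] [MulDistribMulAction G A] [TopologicalSpace A]

/-- **Automorphism pairs act on Kummer classes by pulling back the functions** (`Π`-level form, no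
pull-back to a subgroup): for `(α, β)` an automorphism pair of `(G, G')` over `φ` (`β ∘ φ = φ ∘ α`, `β(A′) ⊆ A′`,
`α⁻¹(H') ⊆ H`) and a homomorphism `ιFn : A → A` with `ιFn (g • f) = α g • ιFn f` and `β (c ζ) = c (Λ(ιFn) ζ)`:
the transport `autMap` of the Kummer class on `H` of the root system `x` of `a` is the Kummer class on `H'` of the
image root system `ιFn ∘ x` of `ιFn a`. [cite: NeukirchSchmidtWingberg2008, I §5] -/
theorem autMap_kummerContClass (c : CyclotomeCoefficients φ A' A) {H H' : Subgroup G}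
    (α : G ≃ₜ* G) (β : G' ≃ₜ* G') (hφ : ∀ g, β (φ g) = φ (α g))
    (hA : ∀ a' : G', a' ∈ A' → β a' ∈ A') (hH : ∀ x, x ∈ H' → α.symm x ∈ H)
    (ιFn : A →* A) (hιFn : ∀ (g : G) (f : A), ιFn (g • f) = α g • ιFn f)
    (hcoeff : ∀ ζ : cyclotome A, coeffMap A' β hA (c.hom ζ) = c.hom (cyclotome.map ιFn ζ))
    {a : A} (x : RootSystem a) (ha : a ∈ MulAction.fixedPoints H A)
    (hx : ∀ n : ℕ+, IsOpen (MulAction.stabilizer G (x.root n) : Set G))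
    (ha' : ιFn a ∈ MulAction.fixedPoints H' A)
    (hx' : ∀ n : ℕ+, IsOpen (MulAction.stabilizer G ((x.map ιFn).root n) : Set G)) :
    autMap φ A' α β hφ hA hH (c.kummerContClass H x ha hx) = c.kummerContClass H' (x.map ιFn) ha' hx' := by
  rw [CyclotomeCoefficients.kummerContClass, CyclotomeCoefficients.kummerContClass, ContH1.mk, ContH1.mk,
    autMap_mk]
  congr 1
  apply Subtype.ext
  funext h'
  change coeffMap A' β hA (c.hom (x.kummerCocycle ha ⟨α.symm (h' : G), hH _ h'.2⟩)) =
    c.hom ((x.map ιFn).kummerCocycle ha' h')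
  rw [hcoeff]
  congr 1
  refine Subtype.ext (funext fun n => ?_)
  simp only [cyclotome.map_apply, RootSystem.kummerCocycle_apply, RootSystem.map_root, map_div]
  change ιFn (α.symm (h' : G) • x.root n) / ιFn (x.root n) = (h' : G) • ιFn (x.root n) / ιFn (x.root n)
  rw [hιFn, ContinuousMulEquiv.apply_symm_apply]

end ContH1Aut

namespace ContH1Aut

variable {G' : Type} [Group G'] [TopologicalSpace G'] (A' : Subgroup G')

/-- If `β` acts TRIVIALLY on the coefficients `A′` (e.g. [EtTh] Prop 2.2 (i): the inversion acts on `Δ_Θ` by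
`+1`), `coeffMap β` is the identity on any value in `A′`. [cite: NeukirchSchmidtWingberg2008, I §5] -/
theorem coeffMap_eq_self_of_forall_eq (β : G' ≃ₜ* G') (hA : ∀ a' : G', a' ∈ A' → β a' ∈ A')
    (hβ : ∀ a' ∈ A', β a' = a') (a : A') : coeffMap A' β hA a = a :=
  Subtype.ext (hβ _ a.2)

end ContH1Aut

end Literature.IUT.HodgeArakelov

/-! ### §2. The inversion on the Kummer class of `Θ̈` and on `η̈^Θ` -/

namespace Literature.AnabelianGeometry.EtaleTheta

namespace ThetaSetting

open Literature.IUT.HodgeArakelov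

variable {p : ℕ} [Fact p.Prime] {D : ThetaSetting p}

namespace ThetaKummerInput

variable (T : D.ThetaKummerInput)

/-- **«Θ̈(Ü) = −Θ̈(Ü⁻¹)» on the Kummer class of `Θ̈` in `H¹(Π^tp_Ÿ, Δ_Θ)`** (no pull-back): for an automorphism
pair `(ι, β)` of `(Π^tp_X, (Π^tp_X)^Θ)` with `ι⁻¹(Π^tp_Ÿ) ⊆ Π^tp_Ÿ` and a pull-back of functions `ιFn` on `Fn` that
is `ι`-twisted equivariant and compatible with `Λ(Fn) → Δ_Θ`, the function-level first equation of Prop 1.4 (ii)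
`hιθ : ιFn Θ̈ = const(−1) · Θ̈` gives `(ι, β)·κ(Θ̈) = κ(−1) · κ(Θ̈)`. [cite: MochizukiEtTh2009, Prop 1.4 (ii) p.22] -/
theorem autMap_kummerTheta (ι : D.PiTemp ≃ₜ* D.PiTemp) (β : D.GtpTheta ≃ₜ* D.GtpTheta)
    (hφ : ∀ g, β (D.toTheta g) = D.toTheta (ι g))
    (hA : ∀ a' : D.GtpTheta, a' ∈ D.DeltaTheta → β a' ∈ D.DeltaTheta)
    (hH : ∀ x, x ∈ D.GtpYdd → ι.symm x ∈ D.GtpYdd)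
    (ιFn : T.Fn →* T.Fn) (hιFn : ∀ (g : D.PiTemp) (f : T.Fn), ιFn (g • f) = ι g • ιFn f)
    (hcoeff : ∀ ζ : cyclotome T.Fn, ContH1Aut.coeffMap D.DeltaTheta β hA (T.coeff.hom ζ) =
      T.coeff.hom (cyclotome.map ιFn ζ))
    (hιθ : ιFn T.theta = T.const (-1) * T.theta) :
    ContH1Aut.autMap D.toTheta D.DeltaTheta ι β hφ hA hH T.kummerTheta = T.kummerConst (-1) * T.kummerTheta := by
  have ha' : ιFn T.theta ∈ MulAction.fixedPoints D.GtpYdd T.Fn := by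
    rw [hιθ]; exact T.const_mul_theta_mem (-1)
  rw [← T.kummer_const_mul_theta (-1), kummerConstMulTheta, kummerTheta,
    ContH1Aut.autMap_kummerContClass T.coeff ι β hφ hA hH ιFn hιFn hcoeff T.thetaRoots T.theta_mem
      (fun _ => T.isOpen_stabilizer _) ha' (fun _ => T.isOpen_stabilizer _)]
  -- the two root systems are root systems of the same element `ιFn Θ̈ = const(−1) · Θ̈`
  have key : ∀ {b : T.Fn} (y : RootSystem b) (hb : b ∈ MulAction.fixedPoints D.GtpYdd T.Fn)
      (_ : b = T.const (-1) * T.theta),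
      T.coeff.kummerContClass D.GtpYdd y hb (fun _ => T.isOpen_stabilizer _) =
        T.coeff.kummerContClass D.GtpYdd ((T.constRoots (-1)).mul T.thetaRoots) (T.const_mul_theta_mem (-1))
          (fun _ => T.isOpen_stabilizer _) := by
    intro b y hb e
    subst e
    exact T.coeff.kummerContClass_eq D.GtpYdd _ _ _ _ _
  exact key _ ha' hιθ

/-- Adding the deck form `hdeck` of the second equation of Prop 1.4 (ii) («`Θ̈(−Ü) = −Θ̈(Ü)`»: every
`ε ∈ Π^tp_Y ∖ Π^tp_Ÿ` pulls `Θ̈` back to `const(−1) · Θ̈`, as in `ThetaKummerDeck.lean`) and ONE deck element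
`ε₀ ∈ Π^tp_Y ∖ Π^tp_Ÿ`: **the pair `(ι, β)` acts on `κ(Θ̈)` exactly as the deck translate `ε₀`**.
[cite: MochizukiEtTh2009, Prop 1.4 (ii) p.22] -/
theorem autMap_kummerTheta_eq_conj [D.GtpYdd.Normal] (ι : D.PiTemp ≃ₜ* D.PiTemp) (β : D.GtpTheta ≃ₜ* D.GtpTheta)
    (hφ : ∀ g, β (D.toTheta g) = D.toTheta (ι g))
    (hA : ∀ a' : D.GtpTheta, a' ∈ D.DeltaTheta → β a' ∈ D.DeltaTheta)
    (hH : ∀ x, x ∈ D.GtpYdd → ι.symm x ∈ D.GtpYdd)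
    (ιFn : T.Fn →* T.Fn) (hιFn : ∀ (g : D.PiTemp) (f : T.Fn), ιFn (g • f) = ι g • ιFn f)
    (hcoeff : ∀ ζ : cyclotome T.Fn, ContH1Aut.coeffMap D.DeltaTheta β hA (T.coeff.hom ζ) =
      T.coeff.hom (cyclotome.map ιFn ζ))
    (hιθ : ιFn T.theta = T.const (-1) * T.theta)
    (hdeck : ∀ ε : D.PiTemp, ε ∈ D.GtpY → ε ∉ D.GtpYdd → ε • T.theta = T.const (-1) * T.theta)
    {ε₀ : D.PiTemp} (hε₁ : ε₀ ∈ D.GtpY) (hε₂ : ε₀ ∉ D.GtpYdd) :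
    ContH1Aut.autMap D.toTheta D.DeltaTheta ι β hφ hA hH T.kummerTheta =
      ContH1.conj D.toTheta D.DeltaTheta ε₀ T.kummerTheta := by
  rw [T.autMap_kummerTheta ι β hφ hA hH ιFn hιFn hcoeff hιθ, T.conj_kummerTheta_of_deck hdeck hε₁ hε₂]

/-- Under «`β` acts on `Δ_Θ` by `+1`» (Prop 2.2 (i) p. 37, the consumer's `hβ`) the coefficient compatibility
`hcoeff` is EQUIVALENT to «`Λ(ιFn)` acts trivially through `Λ(Fn) → Δ_Θ`», `c(Λ(ιFn) ζ) = c(ζ)` (pull-back by an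
automorphism of the curve fixes the roots of unity). [cite: MochizukiEtTh2009, Prop 2.2 (i) p.37] -/
theorem coeffMap_hom_eq_iff_of_acts_trivially (β : D.GtpTheta ≃ₜ* D.GtpTheta)
    (hA : ∀ a' : D.GtpTheta, a' ∈ D.DeltaTheta → β a' ∈ D.DeltaTheta)
    (hβ : ∀ a' ∈ D.DeltaTheta, β a' = a') (ιFn : T.Fn →* T.Fn) (ζ : cyclotome T.Fn) :
    ContH1Aut.coeffMap D.DeltaTheta β hA (T.coeff.hom ζ) = T.coeff.hom (cyclotome.map ιFn ζ) ↔
      T.coeff.hom (cyclotome.map ιFn ζ) = T.coeff.hom ζ := by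
  rw [ContH1Aut.coeffMap_eq_self_of_forall_eq D.DeltaTheta β hA hβ, eq_comm]

end ThetaKummerInput

namespace EtaleThetaData

variable (E : D.EtaleThetaData) (T : D.ThetaKummerInput)

/-- **Prop 1.4 (ii) at the level of the étale theta class, for an INVERSION DATUM of §1.** If `η̈^Θ = κ(Θ̈)`
(`E.etaDd = T.kummerTheta`) and `ι : Π^tp_X ≃ Π^tp_X` carries a theta companion `c` with `ι(Π^tp_Ÿ) = Π^tp_Ÿ`
(Thm 1.6 (i)(ii)), then for every pull-back of functions `ιFn` over `ι` satisfying the function-level package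
(`hιFn`, `hcoeff`, `hιθ`, `hdeck`) and every deck element `ε₀ ∈ Π^tp_Y ∖ Π^tp_Ÿ`: the Thm 1.6 (iii) transport
`transport c h` carries `η̈^Θ` to its conjugate `conj ε₀ η̈^Θ` (abc-iut-L2-t2's `transport_eq_autMap`).
[cite: MochizukiEtTh2009, Prop 1.4 (ii) p.22] -/
theorem transport_etaDd_eq_conj_of_thetaKummer [D.GtpYdd.Normal] (hη : E.etaDd = T.kummerTheta)
    (ι : D.PiTemp ≃ₜ* D.PiTemp) (c : ThetaCompanion ι) (h : Thm16i ι)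
    (ιFn : T.Fn →* T.Fn) (hιFn : ∀ (g : D.PiTemp) (f : T.Fn), ιFn (g • f) = ι g • ιFn f)
    (hcoeff : ∀ ζ : cyclotome T.Fn,
      ContH1Aut.coeffMap D.DeltaTheta c.thetaIso (ThetaCompanion.apply_mem' ι c) (T.coeff.hom ζ) =
        T.coeff.hom (cyclotome.map ιFn ζ))
    (hιθ : ιFn T.theta = T.const (-1) * T.theta)
    (hdeck : ∀ ε : D.PiTemp, ε ∈ D.GtpY → ε ∉ D.GtpYdd → ε • T.theta = T.const (-1) * T.theta)
    {ε₀ : D.PiTemp} (hε₁ : ε₀ ∈ D.GtpY) (hε₂ : ε₀ ∉ D.GtpYdd) :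
    transport c h E.etaDd = ContH1.conj D.toTheta D.DeltaTheta ε₀ E.etaDd := by
  rw [transport_eq_autMap ι c h, hη]
  exact T.autMap_kummerTheta_eq_conj ι c.thetaIso (ThetaCompanion.comm' ι c) (ThetaCompanion.apply_mem' ι c)
    (symm_mem_GtpYdd' ι h) ιFn hιFn hcoeff hιθ hdeck hε₁ hε₂

namespace DoubleUnderline

variable {E} {l : ℕ} (C : E.DoubleUnderline l)

/-- **A deck element inside `Π^tp_X̲̲`**: there is `ε ∈ Π^tp_X̲̲ ∩ Π^tp_Y` with `ε ∉ Π^tp_Ÿ` (the non-trivial deck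
transformation of `Ÿ̲̲ → Y̲̲`), because `[Π^tp_Y̲̲ : Π^tp_Ÿ̲̲] = 2 ≠ 1` (abc-iut-L2-t8's `relIndex_GtpYdd_inf`, under
`Sec2Hyps`; L2-side twin of abc-iut-w4-d010's `EtaleThetaDataOfSetting.exists_deck_element`).
[cite: MochizukiEtTh2009, Def 2.7 p.41] -/
theorem exists_mem_Huu_mem_GtpY_not_mem_GtpYdd (hS : D.Sec2Hyps) :
    ∃ ε ∈ C.Huu, ε ∈ D.GtpY ∧ ε ∉ D.GtpYdd := by
  have h2 : (D.GtpYdd.subgroupOf (C.Huu ⊓ D.GtpY)).index = 2 := C.relIndex_GtpYdd_inf hS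
  have hne : D.GtpYdd.subgroupOf (C.Huu ⊓ D.GtpY) ≠ ⊤ := by
    intro htop
    rw [htop, Subgroup.index_top] at h2
    exact absurd h2 (by norm_num)
  obtain ⟨x, hx⟩ : ∃ x : ↥(C.Huu ⊓ D.GtpY), x ∉ D.GtpYdd.subgroupOf (C.Huu ⊓ D.GtpY) := by
    by_contra hx
    push Not at hx
    exact hne (eq_top_iff.mpr fun x _ => hx x)
  refine ⟨(x : D.PiTemp), (Subgroup.mem_inf.mp x.2).1, (Subgroup.mem_inf.mp x.2).2, ?_⟩
  rwa [Subgroup.mem_subgroupOf] at hx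

/-- **GAP-LEDGER G-L2t2-1, the binder `hιη` — DERIVED from the FUNCTION-level [EtTh] Prop 1.4 package**: for an
inversion datum `(ι, c, h)` of §1, `T : ThetaKummerInput` with `η̈^Θ = κ(Θ̈)`, a pull-back of functions `ιFn` over
`ι` (`hιFn`, `hcoeff`, `hιθ`) and the deck identity `hdeck`, under `Sec2Hyps`:
`∃ τ ∈ Π^tp_X̲̲, transport c h η̈^Θ = conj τ η̈^Θ` (with `τ` the deck element of `Ÿ̲̲ → Y̲̲`).
[cite: MochizukiEtTh2009, Prop 1.4 (ii) p.22] -/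
theorem exists_mem_Huu_transport_etaDd_eq_conj_of_thetaKummer [D.GtpYdd.Normal] (hS : D.Sec2Hyps)
    (hη : E.etaDd = T.kummerTheta) (ι : D.PiTemp ≃ₜ* D.PiTemp) (c : ThetaCompanion ι) (h : Thm16i ι)
    (ιFn : T.Fn →* T.Fn) (hιFn : ∀ (g : D.PiTemp) (f : T.Fn), ιFn (g • f) = ι g • ιFn f)
    (hcoeff : ∀ ζ : cyclotome T.Fn,
      ContH1Aut.coeffMap D.DeltaTheta c.thetaIso (ThetaCompanion.apply_mem' ι c) (T.coeff.hom ζ) =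
        T.coeff.hom (cyclotome.map ιFn ζ))
    (hιθ : ιFn T.theta = T.const (-1) * T.theta)
    (hdeck : ∀ ε : D.PiTemp, ε ∈ D.GtpY → ε ∉ D.GtpYdd → ε • T.theta = T.const (-1) * T.theta) :
    ∃ τ ∈ C.Huu, transport c h E.etaDd = ContH1.conj D.toTheta D.DeltaTheta τ E.etaDd := by
  obtain ⟨ε, hεH, hε₁, hε₂⟩ := C.exists_mem_Huu_mem_GtpY_not_mem_GtpYdd hS
  exact ⟨ε, hεH, E.transport_etaDd_eq_conj_of_thetaKummer T hη ι c h ιFn hιFn hcoeff hιθ hdeck hε₁ hε₂⟩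

/-- The same under «`ι` acts on `Δ_Θ` by `+1`» (`hβ`, Prop 2.2 (i)), with the coefficient compatibility in its
collapsed form `hΛ : c(Λ(ιFn) ζ) = c(ζ)`. [cite: MochizukiEtTh2009, Prop 2.2 (i) p.37] -/
theorem exists_mem_Huu_transport_etaDd_eq_conj_of_thetaKummer_of_acts_trivially [D.GtpYdd.Normal]
    (hS : D.Sec2Hyps) (hη : E.etaDd = T.kummerTheta) (ι : D.PiTemp ≃ₜ* D.PiTemp) (c : ThetaCompanion ι)
    (h : Thm16i ι) (hβ : ∀ a ∈ D.DeltaTheta, c.thetaIso a = a)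
    (ιFn : T.Fn →* T.Fn) (hιFn : ∀ (g : D.PiTemp) (f : T.Fn), ιFn (g • f) = ι g • ιFn f)
    (hΛ : ∀ ζ : cyclotome T.Fn, T.coeff.hom (cyclotome.map ιFn ζ) = T.coeff.hom ζ)
    (hιθ : ιFn T.theta = T.const (-1) * T.theta)
    (hdeck : ∀ ε : D.PiTemp, ε ∈ D.GtpY → ε ∉ D.GtpYdd → ε • T.theta = T.const (-1) * T.theta) :
    ∃ τ ∈ C.Huu, transport c h E.etaDd = ContH1.conj D.toTheta D.DeltaTheta τ E.etaDd :=
  C.exists_mem_Huu_transport_etaDd_eq_conj_of_thetaKummer T hS hη ι c h ιFn hιFn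
    (fun ζ => (T.coeffMap_hom_eq_iff_of_acts_trivially c.thetaIso (ThetaCompanion.apply_mem' ι c) hβ ιFn ζ).2
      (hΛ ζ)) hιθ hdeck

/-! ### §3. END-TO-END: [EtTh] Prop 2.14 (iii), `{±1}`-part at the §1 model, `hιη` DISCHARGED -/

variable {N : ℕ+} (μ : D.CyclotomeMod l N) (ι : D.PiTemp ≃ₜ* D.PiTemp)

/-- **[EtTh] Prop 2.14 (iii), `{±1}`-part, AT THE §1 MODEL — with the class-level binder `hιη` of abc-iut-L2-t2's
`rigidData_exists_monoIso_over_inversion` DISCHARGED by the FUNCTION-level [EtTh] Prop 1.4 package on `Θ̈`**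
(`T`, `η̈^Θ = κ(Θ̈)`, the pull-back `ιFn` over `ι` fixing the roots of unity, `ιFn Θ̈ = −Θ̈`, the deck identity):
for every theta cocycle `η`, some automorphism of the model mono-theta environment `M(η)` induces `ι` on
`Π^tp_Y̲̲`. Residual: the inversion datum, the function-level package, Prop 1.5 (iii), Cor 2.18 (ii) — no
hypothesis on the abstract class `η̈^Θ` remains. [cite: MochizukiEtTh2009, Prop 2.14(iii) p.50] -/
theorem rigidData_exists_monoIso_over_inversion_of_thetaKummer (c : ThetaCompanion ι) (h : Thm16i ι)
    (hι : C.Huu.map ι.toMulEquiv.toMonoidHom = C.Huu) (φ : ↥C.Huu ≃ₜ* ↥C.Huu)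
    (hφ : ∀ x : C.Huu, ((φ x : C.Huu) : D.PiTemp) = ι x) (hC : D.Compat) (hS : D.Sec2Hyps)
    (h15 : Prop15iii E hC) (L : C.CuspLabels) (h218ii : (C.rigidData μ hC hS h15 L).Cor218_ii)
    (hιY : ∀ x : D.PiTemp, x ∈ D.GtpY ↔ ι x ∈ D.GtpY)
    (hιΔ : ∀ x : D.PiTemp, D.aug x = 1 ↔ D.aug (ι x) = 1)
    (hβ : ∀ a ∈ D.DeltaTheta, c.thetaIso a = a)
    -- the FUNCTION-level [EtTh] Prop 1.4 package replacing `hιη`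
    (hη : E.etaDd = T.kummerTheta)
    (ιFn : T.Fn →* T.Fn) (hιFn : ∀ (g : D.PiTemp) (f : T.Fn), ιFn (g • f) = ι g • ιFn f)
    (hΛ : ∀ ζ : cyclotome T.Fn, T.coeff.hom (cyclotome.map ιFn ζ) = T.coeff.hom ζ)
    (hιθ : ιFn T.theta = T.const (-1) * T.theta)
    (hdeck : ∀ ε : D.PiTemp, ε ∈ D.GtpY → ε ∉ D.GtpYdd → ε • T.theta = T.const (-1) * T.theta)
    {η : D.GtpYdd.subgroupOf C.Huu → MuN p N} (hη' : η ∈ C.thetaCocycles hC μ) :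
    ∃ α : ((C.rigidData μ hC hS h15 L).modelMono hη').Iso ((C.rigidData μ hC hS h15 L).modelMono hη'),
      ∀ x, (((CycEnvelope.proj (C.rigidData μ hC hS h15 L).augY (C.rigidData μ hC hS h15 L).chi (α.e x) :
          (C.rigidData μ hC hS h15 L).PiY) : C.Huu) : D.PiTemp) =
        ι ((CycEnvelope.proj (C.rigidData μ hC hS h15 L).augY (C.rigidData μ hC hS h15 L).chi x :
          (C.rigidData μ hC hS h15 L).PiY) : C.Huu) :=
  C.rigidData_exists_monoIso_over_inversion μ ι c h hι φ hφ hC hS h15 L h218ii hιY hιΔ hβ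
    (by
      haveI := hC.GtpYdd_normal
      exact C.exists_mem_Huu_transport_etaDd_eq_conj_of_thetaKummer_of_acts_trivially T hS hη ι c h hβ ιFn
        hιFn hΛ hιθ hdeck)
    hη'

/-- **The same at every level of a `CyclotomeTower`** (Cor 2.18 (ii) supplied by abc-iut-L2-t10's
`rigidData_cor218_ii`): conditional on Prop 1.5 (ii), (iii), the inversion datum and the FUNCTION-level
[EtTh] Prop 1.4 package only — `hιη` discharged. [cite: MochizukiEtTh2009, Prop 2.14(iii) p.50] -/
theorem rigidData_exists_monoIso_over_inversion_tower_of_thetaKummer {Es : Set ℕ+} (τ : D.CyclotomeTower l Es)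
    (M : Es) (c : ThetaCompanion ι) (h : Thm16i ι) (hι : C.Huu.map ι.toMulEquiv.toMonoidHom = C.Huu)
    (φ : ↥C.Huu ≃ₜ* ↥C.Huu) (hφ : ∀ x : C.Huu, ((φ x : C.Huu) : D.PiTemp) = ι x)
    (hC : D.Compat) (hS : D.Sec2Hyps)
    (h15 : Prop15iii E hC) (h15ii : Prop15ii E.toKummerData hC) (L : C.CuspLabels)
    (hιY : ∀ x : D.PiTemp, x ∈ D.GtpY ↔ ι x ∈ D.GtpY)
    (hιΔ : ∀ x : D.PiTemp, D.aug x = 1 ↔ D.aug (ι x) = 1)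
    (hβ : ∀ a ∈ D.DeltaTheta, c.thetaIso a = a)
    -- the FUNCTION-level [EtTh] Prop 1.4 package replacing `hιη`
    (hη : E.etaDd = T.kummerTheta)
    (ιFn : T.Fn →* T.Fn) (hιFn : ∀ (g : D.PiTemp) (f : T.Fn), ιFn (g • f) = ι g • ιFn f)
    (hΛ : ∀ ζ : cyclotome T.Fn, T.coeff.hom (cyclotome.map ιFn ζ) = T.coeff.hom ζ)
    (hιθ : ιFn T.theta = T.const (-1) * T.theta)
    (hdeck : ∀ ε : D.PiTemp, ε ∈ D.GtpY → ε ∉ D.GtpYdd → ε • T.theta = T.const (-1) * T.theta)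
    {η : D.GtpYdd.subgroupOf C.Huu → MuN p M} (hη' : η ∈ C.thetaCocycles hC (τ.mod M)) :
    ∃ α : ((C.rigidData (τ.mod M) hC hS h15 L).modelMono hη').Iso
        ((C.rigidData (τ.mod M) hC hS h15 L).modelMono hη'),
      ∀ x, (((CycEnvelope.proj (C.rigidData (τ.mod M) hC hS h15 L).augY
            (C.rigidData (τ.mod M) hC hS h15 L).chi (α.e x) :
          (C.rigidData (τ.mod M) hC hS h15 L).PiY) : C.Huu) : D.PiTemp) =
        ι ((CycEnvelope.proj (C.rigidData (τ.mod M) hC hS h15 L).augY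
            (C.rigidData (τ.mod M) hC hS h15 L).chi x :
          (C.rigidData (τ.mod M) hC hS h15 L).PiY) : C.Huu) :=
  C.rigidData_exists_monoIso_over_inversion_of_thetaKummer T (τ.mod M) ι c h hι φ hφ hC hS h15 L
    (C.rigidData_cor218_ii τ M hC hS h15 h15ii L) hιY hιΔ hβ hη ιFn hιFn hΛ hιθ hdeck hη'

/-! ### §4. END-TO-END in the `RigidData.Induces` currency of the typed `Prop214_iii_mono` -/

/-- **[EtTh] Prop 2.14 (iii), `{±1}`-part AT THE §1 MODEL, `Induces` form, `hιη` DISCHARGED by the FUNCTION-level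
[EtTh] Prop 1.4 package**: every theta cocycle `η` admits `α ∈ Aut(M(η))` and `a : Π^tp_Y̲̲ ≃ₜ* Π^tp_Y̲̲` with
`R.Induces α a` and `a = ι` on `Π^tp_Y̲̲` (abc-iut-L2-t2's `rigidData_exists_monoIso_induces_over_inversion`); what
remains of the typed clause at `ε = −1` is the LABEL clause `R.ActsOnCuspsBy a s (-1)` (interface input at the
model). [cite: MochizukiEtTh2009, Prop 2.14(iii) p.50] -/
theorem rigidData_exists_monoIso_induces_over_inversion_of_thetaKummer (c : ThetaCompanion ι) (h : Thm16i ι)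
    (hι : C.Huu.map ι.toMulEquiv.toMonoidHom = C.Huu) (φ : ↥C.Huu ≃ₜ* ↥C.Huu)
    (hφ : ∀ x : C.Huu, ((φ x : C.Huu) : D.PiTemp) = ι x) (hC : D.Compat) (hS : D.Sec2Hyps)
    (h15 : Prop15iii E hC) (L : C.CuspLabels) (h218ii : (C.rigidData μ hC hS h15 L).Cor218_ii)
    (hιY : ∀ x : D.PiTemp, x ∈ D.GtpY ↔ ι x ∈ D.GtpY)
    (hιΔ : ∀ x : D.PiTemp, D.aug x = 1 ↔ D.aug (ι x) = 1)
    (hβ : ∀ a ∈ D.DeltaTheta, c.thetaIso a = a)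
    -- the FUNCTION-level [EtTh] Prop 1.4 package replacing `hιη`
    (hη : E.etaDd = T.kummerTheta)
    (ιFn : T.Fn →* T.Fn) (hιFn : ∀ (g : D.PiTemp) (f : T.Fn), ιFn (g • f) = ι g • ιFn f)
    (hΛ : ∀ ζ : cyclotome T.Fn, T.coeff.hom (cyclotome.map ιFn ζ) = T.coeff.hom ζ)
    (hιθ : ιFn T.theta = T.const (-1) * T.theta)
    (hdeck : ∀ ε : D.PiTemp, ε ∈ D.GtpY → ε ∉ D.GtpYdd → ε • T.theta = T.const (-1) * T.theta)
    {η : D.GtpYdd.subgroupOf C.Huu → MuN p N} (hη' : η ∈ C.thetaCocycles hC μ) :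
    ∃ (α : ((C.rigidData μ hC hS h15 L).modelMono hη').Iso ((C.rigidData μ hC hS h15 L).modelMono hη'))
      (a : (C.rigidData μ hC hS h15 L).PiY ≃ₜ* (C.rigidData μ hC hS h15 L).PiY),
      (C.rigidData μ hC hS h15 L).Induces α.e.toMulEquiv a ∧
        ∀ y : (C.rigidData μ hC hS h15 L).PiY,
          (((a y : (C.rigidData μ hC hS h15 L).PiY) : C.Huu) : D.PiTemp) = ι ((y : C.Huu) : D.PiTemp) :=
  C.rigidData_exists_monoIso_induces_over_inversion ι μ c h hι φ hφ hC hS h15 L h218ii hιY hιΔ hβ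
    (by
      haveI := hC.GtpYdd_normal
      exact C.exists_mem_Huu_transport_etaDd_eq_conj_of_thetaKummer_of_acts_trivially T hS hη ι c h hβ ιFn
        hιFn hΛ hιθ hdeck)
    hη'

/-- **The same at every level of a `CyclotomeTower`**, `Induces` form (Cor 2.18 (ii) by abc-iut-L2-t10's
`rigidData_cor218_ii`): conditional on Prop 1.5 (ii), (iii), the inversion datum and the FUNCTION-level [EtTh]
Prop 1.4 package only. [cite: MochizukiEtTh2009, Prop 2.14(iii) p.50] -/
theorem rigidData_exists_monoIso_induces_over_inversion_tower_of_thetaKummer {Es : Set ℕ+}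
    (τ : D.CyclotomeTower l Es) (M : Es) (c : ThetaCompanion ι) (h : Thm16i ι)
    (hι : C.Huu.map ι.toMulEquiv.toMonoidHom = C.Huu)
    (φ : ↥C.Huu ≃ₜ* ↥C.Huu) (hφ : ∀ x : C.Huu, ((φ x : C.Huu) : D.PiTemp) = ι x)
    (hC : D.Compat) (hS : D.Sec2Hyps) (h15 : Prop15iii E hC) (h15ii : Prop15ii E.toKummerData hC)
    (L : C.CuspLabels)
    (hιY : ∀ x : D.PiTemp, x ∈ D.GtpY ↔ ι x ∈ D.GtpY)
    (hιΔ : ∀ x : D.PiTemp, D.aug x = 1 ↔ D.aug (ι x) = 1)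
    (hβ : ∀ a ∈ D.DeltaTheta, c.thetaIso a = a)
    -- the FUNCTION-level [EtTh] Prop 1.4 package replacing `hιη`
    (hη : E.etaDd = T.kummerTheta)
    (ιFn : T.Fn →* T.Fn) (hιFn : ∀ (g : D.PiTemp) (f : T.Fn), ιFn (g • f) = ι g • ιFn f)
    (hΛ : ∀ ζ : cyclotome T.Fn, T.coeff.hom (cyclotome.map ιFn ζ) = T.coeff.hom ζ)
    (hιθ : ιFn T.theta = T.const (-1) * T.theta)
    (hdeck : ∀ ε : D.PiTemp, ε ∈ D.GtpY → ε ∉ D.GtpYdd → ε • T.theta = T.const (-1) * T.theta)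
    {η : D.GtpYdd.subgroupOf C.Huu → MuN p M} (hη' : η ∈ C.thetaCocycles hC (τ.mod M)) :
    ∃ (α : ((C.rigidData (τ.mod M) hC hS h15 L).modelMono hη').Iso
        ((C.rigidData (τ.mod M) hC hS h15 L).modelMono hη'))
      (a : (C.rigidData (τ.mod M) hC hS h15 L).PiY ≃ₜ* (C.rigidData (τ.mod M) hC hS h15 L).PiY),
      (C.rigidData (τ.mod M) hC hS h15 L).Induces α.e.toMulEquiv a ∧
        ∀ y : (C.rigidData (τ.mod M) hC hS h15 L).PiY,
          (((a y : (C.rigidData (τ.mod M) hC hS h15 L).PiY) : C.Huu) : D.PiTemp) =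
            ι ((y : C.Huu) : D.PiTemp) :=
  C.rigidData_exists_monoIso_induces_over_inversion_of_thetaKummer T (τ.mod M) ι c h hι φ hφ hC hS h15 L
    (C.rigidData_cor218_ii τ M hC hS h15 h15ii L) hιY hιΔ hβ hη ιFn hιFn hΛ hιθ hdeck hη'

end DoubleUnderline

end EtaleThetaData

end ThetaSetting

end Literature.AnabelianGeometry.EtaleTheta
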